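import Summits.SmoothPoincare4.SmoothPoincare4.Theses.EntropyRung
import Summits.SmoothPoincare4.SmoothPoincare4.Theorems.EntropyRungSubcylindricalExistenceConformalRealisation
import Literature.Geometry.Lorentzian.ConformalChangeFour
import Literature.Geometry.Lorentzian.AFLinearUniqueness
import Literature.Geometry.Lorentzian.MassCapacityHarmonic
import Literature.Geometry.Lorentzian.DalembertianCompose
import Literature.Geometry.Lorentzian.LeviCivitaProofs
import HarnessLib

/-!
# Conformal covariance of the Laplacian in dimension four and Green data in a conformal gauge
(stub `greenData_conformal`, helper H5 of line `green-blowup-conformal-entropy`, crux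
`EntropyRung.SubcylindricalExistence`, item stmt-SmoothPoincare4-10871)

On a closed smooth `4`-manifold `M` of the summit binder (model `ℝ⁴ = EuclideanSpace ℝ (Fin 4)`,
`I = 𝓡 4`) let `g` be a smooth Riemannian metric, `φ > 0` smooth and `g' = φ² g` (both with their
Levi-Civita connections; `Δ = tr Hess` is the tree's `dalembertian`). Then

* **conformal covariance of the Laplace–Beltrami operator in dimension four**:
  `Δ_g(φ u) = φ³ Δ_{g'} u + u Δ_g φ` for every smooth `u` — equivalently
  `L_{φ²g} u = φ⁻³ L_g(φ u)` for the conformal Laplacian `L = R − 6Δ` (Lee–Parker 1987, (2.7);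
  Aubin 1982, Ch. 6, §6.3). Proof (the two-metrics trick of the dimension-three
  `InitialDataSet.dalembertian_conformal_mul`, `Lorentzian/LaplacianConformalCovariance.lean`):
  for positive `u` the metric `g'' = u² g' = (φ u)² g` (realised by
  `ConformalRealisation.exists_isRiemannian_conformal_sq`) obeys the scalar-curvature law
  `R(ψ² h) ψ³ = R(h) ψ − 6 Δ_h ψ` (`scalarCurvature_conformal_sq_four`, `ConformalChangeFour.lean`)
  three times (`g → g'`, `g' → g''`, `g → g''`), and eliminating `R'`, `R''` gives the identity;
  a general smooth `u` on the compact `M` is `v − K` with `v = u + K > 0`, and constants are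
  removed by linearity of `Δ` (`dalembertian_sub`, `dalembertian_real_comp`).
* **transport of Green data**: if `G` is smooth and positive on `M ∖ {p}` with
  `R_g G − 6 Δ_g G = 0` there and `G → +∞` at `p`, then `G' = G/φ` is smooth and positive on
  `M ∖ {p}`, `R_{g'} G' − 6 Δ_{g'} G' = 0` there, and `G' → +∞` at `p`. Proof: near `x ≠ p`
  globalise `G/φ` to a smooth `u` on `M` (`exists_contMDiff_hasCompactSupport_eventuallyEq`),
  use locality of `Δ` (`dalembertian_congr_of_eventuallyEq`), the covariance identity for `u`
  and `R_{g'} = φ⁻³ (R_g φ − 6 Δ_g φ)`: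
  `φ³ (R' G' − 6 Δ' G') = (Rφ − 6Δφ) G' − 6 (Δ G − G' Δφ) = R G − 6 Δ G = 0`;
  `G/φ ≥ G / max φ → +∞`.

Everything is proved; no definition, no named fact.

References: J. M. Lee, T. H. Parker, *The Yamabe problem*, Bull. AMS 17 (1987) 37–91, (2.7) and
§6 [LeeParker1987]; T. Aubin, *Nonlinear Analysis on Manifolds* (1982), Ch. 6, §6.3, eq. (1)
[Aubin1982]; H. L. Bray, J. Differential Geom. 59 (2001), App. A [BrayRPI2001].
-/

noncomputable section

-- the registered namespace `Summit.SmoothPoincare4.SmoothPoincare4.Theorems` repeats a component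
set_option linter.dupNamespace false

open scoped Manifold ContDiff Topology ENNReal NNReal
open Set Filter MeasureTheory
open Literature.Geometry.Lorentzian Literature.Geometry.Riemannian

namespace Summit.SmoothPoincare4.SmoothPoincare4.Theorems

namespace GreenDataConformal

variable {M : Type*} [TopologicalSpace M] [ChartedSpace (EuclideanSpace ℝ (Fin 4)) M]
  [IsManifold (𝓡 4) ∞ M]

/-- **The Laplace–Beltrami operator of an affine function of `f`**: `Δ_g (a f + b) = a Δ_g f` at a
point where `f` is `C²` (the chain rule `dalembertian_real_comp` with `ζ(s) = a s + b`, `ζ' = a`,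
`ζ'' = 0`; the `𝓡 4` copy of `dalembertian_affine_apply`, `MassCapacityPotential.lean`).
O'Neill 1983, Ch. 3, Def. 3.50. [folklore] -/
theorem dalembertian_affine
    (g : PseudoRiemannianMetric (𝓡 4) ∞ (EuclideanSpace ℝ (Fin 4)) (TangentSpace (𝓡 4) : M → Type _))
    [g.HasLeviCivita] {f : M → ℝ} {x : M} (a b : ℝ) (hf : ContMDiffAt (𝓡 4) 𝓘(ℝ, ℝ) 2 f x) :
    g.dalembertian (fun y ↦ a * f y + b) x = a * g.dalembertian f x := by
  have hζ : ContDiffAt ℝ 2 (fun s : ℝ ↦ a * s + b) (f x) :=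
    ((contDiff_const.mul contDiff_id).add contDiff_const).contDiffAt
  have hd : deriv (fun s : ℝ ↦ a * s + b) = fun _ ↦ a := by
    funext s
    have : HasDerivAt (fun s : ℝ ↦ a * s + b) a s := by
      simpa using ((hasDerivAt_id s).const_mul a).add_const b
    exact this.deriv
  have hdd : deriv (deriv (fun s : ℝ ↦ a * s + b)) = fun _ ↦ 0 := by
    rw [hd]
    funext s
    exact deriv_const s a
  have key := g.dalembertian_real_comp hf hζ
  rw [hdd, hd] at key
  rw [show (fun y ↦ a * f y + b) = (fun s : ℝ ↦ a * s + b) ∘ f from rfl, key]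
  ring

/-- **`Δ_g(φ u) = φ³ Δ_{φ²g} u + u Δ_g φ` for positive smooth `u`** (dimension four). Both
`u² (φ² g)` and `(φ u)² g` are the same metric `g''`, so the scalar-curvature law
`R(ψ²h) ψ³ = R(h) ψ − 6 Δ_h ψ` (`scalarCurvature_conformal_sq_four`) gives
`R'' u³ = R' u − 6 Δ' u` and `R'' (φu)³ = R φ u − 6 Δ(φ u)`, and with `R' φ³ = R φ − 6 Δ φ` the
scalar curvatures cancel. Lee–Parker 1987, (2.7); Bray 2001, App. A (dimension three).
[cite: LeeParker1987, (2.7)] -/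
theorem dalembertian_conformal_mul_of_pos
    (g g' : PseudoRiemannianMetric (𝓡 4) ∞ (EuclideanSpace ℝ (Fin 4)) (TangentSpace (𝓡 4) : M → Type _))
    [g.HasLeviCivita] [g'.HasLeviCivita] (hg : g.IsRiemannian)
    {φ : M → ℝ} (hφ : ContMDiff (𝓡 4) 𝓘(ℝ, ℝ) ∞ φ) (hφpos : ∀ x, 0 < φ x)
    (hgg' : ∀ (x : M) (v w : TangentSpace (𝓡 4) x), g'.val x v w = φ x ^ 2 * g.val x v w)
    {u : M → ℝ} (hu : ContMDiff (𝓡 4) 𝓘(ℝ, ℝ) ∞ u) (hupos : ∀ x, 0 < u x) (x : M) :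
    g.dalembertian (fun y ↦ φ y * u y) x =
      φ x ^ 3 * g'.dalembertian u x + u x * g.dalembertian φ x := by
  have hE : Module.finrank ℝ (EuclideanSpace ℝ (Fin 4)) = 4 := finrank_euclideanSpace_fin
  -- `g'` is Riemannian
  have hg' : g'.IsRiemannian := fun y v hv ↦ by
    rw [hgg' y v v]
    exact mul_pos (pow_pos (hφpos y) 2) (hg y v hv)
  -- the metric `g'' = u² g' = (φ u)² g` with its Levi-Civita connection
  obtain ⟨g'', -, hg''⟩ := ConformalRealisation.exists_isRiemannian_conformal_sq g' hg' hu hupos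
  haveI : g''.HasLeviCivita := g''.hasLeviCivita
  have hφu : ContMDiff (𝓡 4) 𝓘(ℝ, ℝ) ∞ (fun y ↦ φ y * u y) := hφ.mul hu
  have hφupos : ∀ y, 0 < φ y * u y := fun y ↦ mul_pos (hφpos y) (hupos y)
  have hgg'' : ∀ (y : M) (v w : TangentSpace (𝓡 4) y),
      g''.val y v w = (fun z ↦ φ z * u z) y ^ 2 * g.val y v w := fun y v w ↦ by
    rw [hg'' y v w, hgg' y v w]
    ring
  -- the three instances of the scalar-curvature law
  have L0 := PseudoRiemannianMetric.scalarCurvature_conformal_sq_four hE g g' hφ hφpos hgg' x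
  have L1 := PseudoRiemannianMetric.scalarCurvature_conformal_sq_four hE g' g'' hu hupos hg'' x
  have L2 := PseudoRiemannianMetric.scalarCurvature_conformal_sq_four hE g g'' hφu hφupos hgg'' x
  have hφ3 : φ x ^ 3 ≠ 0 := pow_ne_zero 3 (hφpos x).ne'
  have hu3 : u x ^ 3 ≠ 0 := pow_ne_zero 3 (hupos x).ne'
  have hφu3 : (φ x * u x) ^ 3 ≠ 0 := pow_ne_zero 3 (hφupos x).ne'
  have e0 : φ x ^ 3 * g'.scalarCurvature x =
      g.scalarCurvature x * φ x - 6 * g.dalembertian φ x := (eq_inv_mul_iff_mul_eq₀ hφ3).1 L0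
  have e1 : u x ^ 3 * g''.scalarCurvature x =
      g'.scalarCurvature x * u x - 6 * g'.dalembertian u x := (eq_inv_mul_iff_mul_eq₀ hu3).1 L1
  have e2 : (φ x * u x) ^ 3 * g''.scalarCurvature x =
      g.scalarCurvature x * (φ x * u x) - 6 * g.dalembertian (fun y ↦ φ y * u y) x :=
    (eq_inv_mul_iff_mul_eq₀ hφu3).1 L2
  linear_combination (e2 - φ x ^ 3 * e1 - u x * e0) / 6

/-- **Conformal covariance of the Laplace–Beltrami operator in dimension four**:
`Δ_g(φ u) = φ³ Δ_{φ²g} u + u Δ_g φ` for every smooth `u` on a compact `M` (smooth `φ > 0`,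
`g' = φ² g`). Reduction to the positive case: `v = u + K` is positive for `K = 1 − min u`,
`Δ_{g'} v = Δ_{g'} u` and `Δ_g(φ u) = Δ_g(φ v) − K Δ_g φ` (`dalembertian_affine`,
`dalembertian_sub`). Lee–Parker 1987, (2.7) (`L_{φ²g} u = φ⁻³ L_g(φu)`, `L = R − 6Δ` in
dimension four). [cite: LeeParker1987, (2.7)] -/
theorem dalembertian_conformal_mul [CompactSpace M]
    (g g' : PseudoRiemannianMetric (𝓡 4) ∞ (EuclideanSpace ℝ (Fin 4)) (TangentSpace (𝓡 4) : M → Type _))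
    [g.HasLeviCivita] [g'.HasLeviCivita] (hg : g.IsRiemannian)
    {φ : M → ℝ} (hφ : ContMDiff (𝓡 4) 𝓘(ℝ, ℝ) ∞ φ) (hφpos : ∀ x, 0 < φ x)
    (hgg' : ∀ (x : M) (v w : TangentSpace (𝓡 4) x), g'.val x v w = φ x ^ 2 * g.val x v w)
    {u : M → ℝ} (hu : ContMDiff (𝓡 4) 𝓘(ℝ, ℝ) ∞ u) (x : M) :
    g.dalembertian (fun y ↦ φ y * u y) x =
      φ x ^ 3 * g'.dalembertian u x + u x * g.dalembertian φ x := by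
  -- a constant `K` with `u + K > 0` on the compact `M`
  obtain ⟨xm, -, hxm⟩ :=
    isCompact_univ.exists_isMinOn ⟨x, mem_univ x⟩ hu.continuous.continuousOn
  obtain ⟨K, hK⟩ : ∃ K : ℝ, K = 1 - u xm := ⟨_, rfl⟩
  have hvpos : ∀ y, 0 < 1 * u y + K := fun y ↦ by
    have h1 : u xm ≤ u y := hxm (mem_univ y)
    rw [hK]
    linarith
  have hv : ContMDiff (𝓡 4) 𝓘(ℝ, ℝ) ∞ (fun y ↦ 1 * u y + K) :=
    (contMDiff_const.mul hu).add contMDiff_const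
  have key := dalembertian_conformal_mul_of_pos g g' hg hφ hφpos hgg' hv hvpos x
  -- regularity at `x`
  have h2le : (2 : ℕ∞ω) ≤ ((⊤ : ℕ∞) : ℕ∞ω) := WithTop.coe_le_coe.mpr le_top
  have hu2 : ContMDiffAt (𝓡 4) 𝓘(ℝ, ℝ) 2 u x := (hu x).of_le h2le
  have hφ2 : ContMDiffAt (𝓡 4) 𝓘(ℝ, ℝ) 2 φ x := (hφ x).of_le h2le
  have hφv2 : ContMDiffAt (𝓡 4) 𝓘(ℝ, ℝ) 2 (fun y ↦ φ y * (1 * u y + K)) x :=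
    ((hφ.mul hv) x).of_le h2le
  have hKφ2 : ContMDiffAt (𝓡 4) 𝓘(ℝ, ℝ) 2 (fun y ↦ K * φ y + 0) x :=
    (contMDiffAt_const.mul hφ2).add contMDiffAt_const
  -- `Δ' (u + K) = Δ' u`
  have hb : g'.dalembertian (fun y ↦ 1 * u y + K) x = g'.dalembertian u x := by
    rw [dalembertian_affine g' 1 K hu2, one_mul]
  -- `Δ(φ u) = Δ(φ (u + K)) − K Δ φ`
  have hfun : (fun y ↦ φ y * u y) =
      (fun y ↦ φ y * (1 * u y + K)) - fun y ↦ K * φ y + 0 := by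
    funext y
    simp only [Pi.sub_apply]
    ring
  have ha : g.dalembertian (fun y ↦ φ y * u y) x =
      g.dalembertian (fun y ↦ φ y * (1 * u y + K)) x - K * g.dalembertian φ x := by
    rw [hfun, dalembertian_sub g hφv2 hKφ2, dalembertian_affine g K 0 hφ2]
  rw [ha, key, hb]
  ring

/-- **Transport of Green data to the conformal gauge `g' = φ² g`** (dimension four). If `G` is
smooth and positive on `M ∖ {p}`, `R_g G − 6 Δ_g G = 0` there and `G → +∞` at `p`, then
`G' = G/φ` is smooth and positive on `M ∖ {p}`, solves `R_{g'} G' − 6 Δ_{g'} G' = 0` there, and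
`G' → +∞` at `p`: near `x ≠ p` the quotient `G/φ` is globalised to a smooth `u`
(`exists_contMDiff_hasCompactSupport_eventuallyEq`), `Δ` is local
(`dalembertian_congr_of_eventuallyEq`), and by `dalembertian_conformal_mul` and
`R_{g'} φ³ = R_g φ − 6 Δ_g φ` one gets `φ³ (R' G' − 6 Δ' G') = R G − 6 Δ G = 0`; finally
`G/φ ≥ G / max φ`. Lee–Parker 1987, (2.7) and §6 (conformal invariance of the Green function of
the conformal Laplacian). [cite: LeeParker1987, (2.7) and §6] -/
theorem greenData_transport [T2Space M] [CompactSpace M]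
    (g g' : PseudoRiemannianMetric (𝓡 4) ∞ (EuclideanSpace ℝ (Fin 4)) (TangentSpace (𝓡 4) : M → Type _))
    [g.HasLeviCivita] [g'.HasLeviCivita] (hg : g.IsRiemannian)
    {φ : M → ℝ} (hφ : ContMDiff (𝓡 4) 𝓘(ℝ, ℝ) ∞ φ) (hφpos : ∀ x, 0 < φ x)
    (hgg' : ∀ (x : M) (v w : TangentSpace (𝓡 4) x), g'.val x v w = φ x ^ 2 * g.val x v w)
    {p : M} {G : M → ℝ} (hGs : ContMDiffOn (𝓡 4) 𝓘(ℝ, ℝ) ∞ G {p}ᶜ)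
    (hGpos : ∀ x, x ≠ p → 0 < G x)
    (hGpde : ∀ x, x ≠ p → g.scalarCurvature x * G x - 6 * g.dalembertian G x = 0)
    (hGlim : Tendsto G (𝓝[≠] p) atTop) :
    ContMDiffOn (𝓡 4) 𝓘(ℝ, ℝ) ∞ (fun x ↦ G x / φ x) {p}ᶜ ∧ (∀ x, x ≠ p → 0 < G x / φ x) ∧
      (∀ x, x ≠ p →
        g'.scalarCurvature x * (G x / φ x) - 6 * g'.dalembertian (fun y ↦ G y / φ y) x = 0) ∧
      Tendsto (fun x ↦ G x / φ x) (𝓝[≠] p) atTop := by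
  have hE : Module.finrank ℝ (EuclideanSpace ℝ (Fin 4)) = 4 := finrank_euclideanSpace_fin
  have hws : ContMDiffOn (𝓡 4) 𝓘(ℝ, ℝ) ∞ (fun x ↦ G x / φ x) {p}ᶜ :=
    hGs.div₀ hφ.contMDiffOn fun x _ ↦ (hφpos x).ne'
  refine ⟨hws, fun x hx ↦ div_pos (hGpos x hx) (hφpos x), fun x hx ↦ ?_, ?_⟩
  · -- globalise `G/φ` near `x ≠ p`
    obtain ⟨u, hu, -, -, V, -, hxV, -, hV⟩ :=
      exists_contMDiff_hasCompactSupport_eventuallyEq (I := 𝓡 4) isOpen_compl_singleton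
        isCompact_singleton (singleton_subset_iff.2 hx) hws
    have hux : u =ᶠ[𝓝 x] fun y ↦ G y / φ y := hV x (hxV (mem_singleton x))
    have hφu : (fun y ↦ φ y * u y) =ᶠ[𝓝 x] G := hux.mono fun y hy ↦ by
      show φ y * u y = G y
      rw [hy]
      exact mul_div_cancel₀ (G y) (hφpos y).ne'
    have hux' : u x = G x / φ x := hux.eq_of_nhds
    -- the covariance identity for `u`, read through locality
    have hcov := dalembertian_conformal_mul g g' hg hφ hφpos hgg' hu x
    rw [g.dalembertian_congr_of_eventuallyEq hφu, hux'] at hcov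
    have hb : g'.dalembertian (fun y ↦ G y / φ y) x = g'.dalembertian u x :=
      g'.dalembertian_congr_of_eventuallyEq hux.symm
    rw [hb, PseudoRiemannianMetric.scalarCurvature_conformal_sq_four hE g g' hφ hφpos hgg' x]
    -- algebra
    have hφ0 : φ x ≠ 0 := (hφpos x).ne'
    have hφ3 : φ x ^ 3 ≠ 0 := pow_ne_zero 3 hφ0
    have hGx : g.scalarCurvature x * φ x * (G x / φ x) = g.scalarCurvature x * G x := by
      rw [mul_assoc, mul_div_cancel₀ _ hφ0]
    have hpde := hGpde x hx
    have key : (g.scalarCurvature x * φ x - 6 * g.dalembertian φ x) * (G x / φ x) -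
        6 * (φ x ^ 3 * g'.dalembertian u x) = 0 := by
      linear_combination hGx + hpde + 6 * hcov
    have hi : (φ x ^ 3)⁻¹ * φ x ^ 3 = 1 := inv_mul_cancel₀ hφ3
    linear_combination (φ x ^ 3)⁻¹ * key + 6 * g'.dalembertian u x * hi
  · -- `G/φ ≥ G / max φ → +∞` at `p`
    obtain ⟨xM, -, hxM⟩ :=
      isCompact_univ.exists_isMaxOn ⟨p, mem_univ p⟩ hφ.continuous.continuousOn
    have hle : ∀ x, φ x ≤ φ xM := fun x ↦ hxM (mem_univ x)
    refine tendsto_atTop_mono' _ ?_ (hGlim.atTop_div_const (hφpos xM))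
    filter_upwards [self_mem_nhdsWithin] with x hx
    exact div_le_div_of_nonneg_left (hGpos x hx).le (hφpos x) (hle x)

end GreenDataConformal

/-- **Helper H5 — conformal covariance of the Laplacian in dimension four and Green data in a
conformal gauge** (registered stub `greenData_conformal` of line `green-blowup-conformal-entropy`).
For a smooth Riemannian `g` with Levi-Civita connection on a closed smooth `4`-manifold of the
summit binder, a smooth `φ > 0` and a smooth metric `g'` with Levi-Civita connection and
`g' = φ² g` pointwise: (a) `Δ_g(φ u) = φ³ Δ_{g'} u + u Δ_g φ` for every smooth `u`
(`L_{φ²g} u = φ⁻³ L_g(φ u)`, Lee–Parker 1987, (2.7)); (b) Green data `(p, G)` of `L_g = R_g − 6Δ_g`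
transport to the Green data `(p, G/φ)` of `L_{g'}`. Assembled from
`GreenDataConformal.dalembertian_conformal_mul` and `GreenDataConformal.greenData_transport`.
[cite: LeeParker1987, (2.7) and §6] -/
theorem greenData_conformal :
    ∀ (M : Type) [TopologicalSpace M] [T2Space M] [SecondCountableTopology M]
      [ChartedSpace (EuclideanSpace ℝ (Fin 4)) M] [IsManifold (𝓡 4) ∞ M] [CompactSpace M]
      [T3Space M] [MeasurableSpace M] [BorelSpace M]
      (g : PseudoRiemannianMetric (𝓡 4) ∞ (EuclideanSpace ℝ (Fin 4)) (TangentSpace (𝓡 4) : M → Type _))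
      [g.HasLeviCivita], g.IsRiemannian → ∀ (φ : M → ℝ), ContMDiff (𝓡 4) 𝓘(ℝ, ℝ) ∞ φ → (∀ x, 0 < φ x) →
      ∀ (g' : PseudoRiemannianMetric (𝓡 4) ∞ (EuclideanSpace ℝ (Fin 4)) (TangentSpace (𝓡 4) : M → Type _))
        [g'.HasLeviCivita], (∀ (x : M) (v w : TangentSpace (𝓡 4) x), g'.val x v w = φ x ^ 2 * g.val x v w) →
      (∀ u : M → ℝ, ContMDiff (𝓡 4) 𝓘(ℝ, ℝ) ∞ u → ∀ x,
          g.dalembertian (fun y ↦ φ y * u y) x = φ x ^ 3 * g'.dalembertian u x + u x * g.dalembertian φ x) ∧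
      ∀ (p : M) (G : M → ℝ),
        (ContMDiffOn (𝓡 4) 𝓘(ℝ, ℝ) ∞ G {p}ᶜ ∧ (∀ x, x ≠ p → 0 < G x) ∧
          (∀ x, x ≠ p → g.scalarCurvature x * G x - 6 * g.dalembertian G x = 0) ∧
          Tendsto G (𝓝[≠] p) atTop) →
        (ContMDiffOn (𝓡 4) 𝓘(ℝ, ℝ) ∞ (fun x ↦ G x / φ x) {p}ᶜ ∧ (∀ x, x ≠ p → 0 < G x / φ x) ∧
          (∀ x, x ≠ p → g'.scalarCurvature x * (G x / φ x) - 6 * g'.dalembertian (fun y ↦ G y / φ y) x = 0) ∧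
          Tendsto (fun x ↦ G x / φ x) (𝓝[≠] p) atTop) := by
  intro M _ _ _ _ _ _ _ _ _ g _ hg φ hφ hφpos g' _ hgg'
  exact ⟨fun u hu x ↦ GreenDataConformal.dalembertian_conformal_mul g g' hg hφ hφpos hgg' hu x,
    fun p G hGreen ↦ GreenDataConformal.greenData_transport g g' hg hφ hφpos hgg' hGreen.1
      hGreen.2.1 hGreen.2.2.1 hGreen.2.2.2⟩

end Summit.SmoothPoincare4.SmoothPoincare4.Theorems

end
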